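import Summits.ResolutionOfSingularities.ResolutionOfSingularities.Theorems.FrobeniusLadderFInjectiveMacaulayficationFHalfRowOfProductCentre
import Summits.ResolutionOfSingularities.ResolutionOfSingularities.Theorems.FrobeniusLadderFInjectiveMacaulayficationP2d4F5TauKBlowupFull
import HarnessLib

/-!
# F4POS-2 BED ROW 2: the τ-floor of P2d4F5 is cured by ONE fibre-supported blowing up — the F-half's conclusion at `(4, 2, P2d4F5, v, Bl_τ, τ·𝒪)`, UNCONDITIONAL
# (crux `FInjectiveMacaulayfication` stmt-ResolutionOfSingularities-15315, chain w45a; res-L1-w45a-plan-1 RULING R18.19 (2) + SEAT TABLE v31.9 «idea-1 bed certs →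
# stub-2 bed certs → stub-3 bed rows»; filed by res-L1-w45a-stub-2 g8 in res-L1-w45a-stub-3's absence (end of generation 9, STATUS l.79990) — the term is the one announced
# l.80026; twin of res-L1-w45a-stub-3's `TauFloorP2d4CRow.tauFloor_P2d4C_row` p620828)

[OURS · L1 W4.5a] Support file (`--supports stmt-ResolutionOfSingularities-15315 --as helper`); def-free, unconditional; replaces the role of NO printed item;
NOT a statement of the manuscript; AI-written (AI review is weaker than expert review).

`X = Spec (k[X₀..X₄]/(f))`, `f = X₄² + X₀²X₄ + X₁⁵ + X₂⁵ + X₃⁵` (P2d4F5: `z² + x²z + y⁵ + u⁵ + t⁵`, the `λ = x²` class whose point blow-up is non-normal, res-L1-w45a-idea-1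
FB5-r2 (iii)), `char k = 2` (any field), `v` = the vertex, `τ = (x̄, ȳ², ū², t̄², z̄)` = the τ-tower's floor-0 centre (res-L1-w45a-idea-1 FB5-r4 / TAU-PROBE). THEN: for
EVERY blowing up `g : S′ → Spec 𝒪_{X,v}` along `τ·𝒪_{X,v}` there is `𝓚 ≠ ⊥` on `S′`, supported over the closed point, ALL of whose blowings up are FULL at every stalk.
One term: res-L1-w45a-stub-3's generic `FHalfRowOfProductCentre.fHalfConclusion_of_affineBlowup_mul` (p618085 §2) on res-L1-w45a-stub-2's product-centre row
`P2d4F5TauKBlowupFull.hrow_P2d4F5` (cert 87a0747d2484a4b2: `Bl_{τ·K} X` FULL at every point, `K` = 49 monomials, `𝔪_v ⊆ √K`).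
CENSUS NOTE (res-L1-w45a-tri-2's lens, as for row 1): the OUTPUT here is an F(4)-iso-currency fact about `(X, v)` with centre `τ·K`; what makes it «F(4)-pos row 2» is
the INPUT legality of `S′ = Bl_τ X` — CM (4/4 charts CI), NOT normal, non-FULL along a positive-dimensional locus — which is res-L1-w45a-idea-1's atlas
(`fb5r4/tau/`, evidence level) until typed. [OURS · certificate instance] [cite: StacksProject, Tag 080A] [cite: GortzWedhorn2020, Prop. 13.92]
-/

-- single-problem summit: the doubled namespace component is forced
set_option linter.dupNamespace false

noncomputable section

open AlgebraicGeometry CategoryTheory Literature.AlgebraicGeometry.Resolution TopologicalSpace IsLocalRing MvPolynomial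

namespace Summit.ResolutionOfSingularities.ResolutionOfSingularities.Theorems.FInjectiveMacaulayfication.TauFloorP2d4F5Row

open Summit.ResolutionOfSingularities.ResolutionOfSingularities.Theorems.FInjectiveMacaulayfication
open SliceableCentre

/-- ★★★ **F4POS-2 BED ROW 2 (P2d4F5), UNCONDITIONAL.** See the module docstring. [OURS · certificate instance] [cite: StacksProject, Tag 080A] -/
theorem tauFloor_P2d4F5_row (k : Type) [Field k] [CharP k 2] (f : MvPolynomial (Fin 5) k)
    (hf : f = X 4 ^ 2 + X 0 ^ 2 * X 4 + X 1 ^ 5 + X 2 ^ 5 + X 3 ^ 5)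
    (v : Spec (.of (MvPolynomial (Fin 5) k ⧸ Ideal.span {f})))
    (hv : v.asIdeal = Ideal.span (Set.range fun j : Fin 5 => Ideal.Quotient.mk (Ideal.span {f}) (X j))) :
    ∀ (S' : Scheme.{0}) (g : S' ⟶ Spec ((Spec (.of (MvPolynomial (Fin 5) k ⧸ Ideal.span {f}))).presheaf.stalk v)),
      IsBlowup g ((affineBlowup.idealSheaf
        (Ideal.span {Ideal.Quotient.mk (Ideal.span {f}) (X 0), Ideal.Quotient.mk (Ideal.span {f}) (X 1) ^ 2,
          Ideal.Quotient.mk (Ideal.span {f}) (X 2) ^ 2, Ideal.Quotient.mk (Ideal.span {f}) (X 3) ^ 2, Ideal.Quotient.mk (Ideal.span {f}) (X 4)})).comap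
        ((Spec (.of (MvPolynomial (Fin 5) k ⧸ Ideal.span {f}))).fromSpecStalk v)) →
      ∃ 𝓚 : S'.IdealSheafData, 𝓚 ≠ ⊥ ∧
        (∀ s ∈ (𝓚.support : Set S'), g.base s = closedPoint ((Spec (.of (MvPolynomial (Fin 5) k ⧸ Ideal.span {f}))).presheaf.stalk v)) ∧
        ∀ (S'' : Scheme.{0}) (π : S'' ⟶ S'), IsBlowup π 𝓚 → ∀ s : S'', FullCl 2 (S''.presheaf.stalk s) := by
  haveI hp : (Ideal.span {f}).IsPrime :=
    (Ideal.span_singleton_prime (P2d4F5Specimen.prime_f k f hf).ne_zero).mpr (P2d4F5Specimen.prime_f k f hf)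
  haveI : IsDomain (MvPolynomial (Fin 5) k ⧸ Ideal.span {f}) := Ideal.Quotient.isDomain _
  exact FHalfRowOfProductCentre.fHalfConclusion_of_affineBlowup_mul 2 _ _ (P2d4F5TauKBlowupFull.span_tau_ne_bot k f hf)
    (P2d4F5TauKBlowupFull.span_KA_ne_bot k f hf) v (by rw [hv]; exact P2d4F5TauKBlowupFull.span_range_X_le_radical_span_KA k f)
    (P2d4F5TauKBlowupFull.hrow_P2d4F5 k f hf)

end Summit.ResolutionOfSingularities.ResolutionOfSingularities.Theorems.FInjectiveMacaulayfication.TauFloorP2d4F5Row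

end
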